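import Summits.Ventures.CertifiedArithmetic.LowPrec.SRBlockScaleRules
import HarnessLib

/-!
# Block-scaled quantisation under stochastic rounding, III: scale SELECTION (file LIII)

HONEST FRAMING: certified error envelopes and provably optimal rounding/accumulation schemes for
low-precision formats under stated cost models; every table by two implementations; no hardware or
vendor claims.

[CookEtAl2025] ("Four Over Six", §3) quantise each NVFP4 block twice — once so that the block
maximum lands on `6 = max FP4`, once so that it lands on `4` — and keep the copy with the smaller
realised squared error; their App. A.3 notes that with stochastically rounded gradients "bias is
reintroduced in a way that favors reduced quantization error", lists two unbiased alternatives
(no selection; select by the round-to-nearest error, then round stochastically) and leaves the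
evaluation "to future work".  [PanferovEtAl2026, §4.2] state that "picking a lower MSE scale branch
introduces bias, even if both scale branches are individually unbiased via SR" and validate it
empirically.  This file settles the exact content, kernel-checked:

* `sel_unbiased_of_admissible` — **ANY INPUT-MEASURABLE SELECTION among individually unbiased
  scales is unbiased**: if the scale `σ(V)` is a function of the INPUT block with
  `blockMax V ≤ σ(V)·maxRat`, every element is unbiased.  In particular `varSelScale` — select, of
  two admissible scales, the one with the smaller EXACT CONDITIONAL SR VARIANCE
  `Σᵢ s²·v_φ(Vᵢ/s)` (a rational function of the input, no rounding needed) — is unbiased AND has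
  the smaller block variance of the two (`varSel_unbiased`, `blockVar_varSel_le`): the unbiased,
  variance-optimal form of "4/6" under SR.  (Selecting by the RN error, Cook et al.'s option 2, is
  input-measurable too, hence unbiased, but not variance-optimal.)
* `selStep` / `blockSel` — REALISED-ERROR SELECTION between two independent stochastic roundings
  (element form: keep the nearer candidate; block form: keep the copy with the smaller realised sum
  of squared errors, ties to the first scale — the published rule);
  `selStep_eq_of_closer` — if both candidates of the first scale are at least as close to `v` as
  both candidates of the second, selection never fires and the estimate stays unbiased (so the bias
  is block-dependent, not universal);
* `FP4Sel.*` — **THE BIAS, EXACTLY**: block `(6, 11/2)` in E2M1 with the two 4/6 scales `1`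
  (maximum ↦ 6) and `3/2` (maximum ↦ 4): both scales are unbiased; realised-SSE selection delivers
  the second element with mean `47/8 ≠ 11/2` (bias `+3/8`, toward the nearer grid point `6` —
  "favors reduced quantization error"), whichever scale is the default; and `any_coupling` — for
  EVERY joint law of the two roundings with the SR marginals the mean is `≥ 45/8 > 11/2`: no
  coupling of the random bits (shared or independent) rescues unbiasedness.  Conversely on this
  block the conditional-variance rule picks scale `3/2` (variances `1/2 < 3/4`) and is unbiased;
* `FP4Sel.curve` — **THE BIAS CURVE**: on the blocks `(6, v)`, `v ∈ (9/2, 6)`, the realised-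
  selection mean is an explicit piecewise quadratic: bias `−(2/3)(v − 9/2)(6 − v) < 0` on
  `(9/2, 5)`, exactly `0` on `(5, 21/4)`, `(6 − v)(v − 4)/2 > 0` on `[21/4, 6)` — the sign flips
  inside one binade (`dn_up_of_cell` pins the SR cells symbolically).

References: [CookEtAl2025] §3, Table 4, App. A.3; [PanferovEtAl2026] §3, §4.2, App. A;
[TsengYuPark2025] §3.1; [RouhaniEtAl2023MX] §3; [ConnollyHighamMary2021] Lemma 4.4.
-/

namespace Summit.Ventures.CertifiedArithmetic.LowPrec.SR

open Literature.ComputerArithmetic.ConnollyHighamMary2021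
open Literature.ComputerArithmetic.FloatingPoint
open Literature.ComputerArithmetic.FloatingPoint.MXBlock
open Finset

/-! ### Input-measurable selection is unbiased; the conditional-variance rule -/

section Measurable

variable {φ : Format} {k : ℕ}

/-- **ANY INPUT-MEASURABLE ADMISSIBLE SCALE SELECTION IS UNBIASED**: if the scale is chosen as a
function `σ` of the input block and never clips it, every element is unbiased under SR. -/
theorem sel_unbiased_of_admissible (σ : (Fin k → ℚ) → ℚ) (hσ : ∀ V, 0 < σ V)
    (hadm : ∀ V, blockMax V ≤ σ V * φ.maxRat) (V : Fin k → ℚ) (i : Fin k) :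
    scaledStep (MiniFloat.valueSet φ) (σ V) (V i) (fun y => y) = V i :=
  (mx_block_unbiased_iff (hσ V) V).mpr (hadm V) i

/-- The block's total SR variance at scale `s` (sum of the exact conditional variances; for an
admissible scale it is `Σᵢ s²·v_φ(Vᵢ/s)`, `mx_var_eq`). -/
def blockVar (φ : Format) (s : ℚ) (V : Fin k → ℚ) : ℚ :=
  ∑ i, scaledStep (MiniFloat.valueSet φ) s (V i) (fun y => (y - V i) ^ 2)

/-- **CONDITIONAL-VARIANCE SELECTION** between two candidate scales: keep the one with the smaller
exact block variance (ties to the first).  A function of the INPUT only. -/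
def varSelScale (φ : Format) (s₁ s₂ : ℚ) (V : Fin k → ℚ) : ℚ :=
  if blockVar φ s₂ V < blockVar φ s₁ V then s₂ else s₁

/-- The conditional-variance rule is unbiased whenever both candidates are admissible. -/
theorem varSel_unbiased {s₁ s₂ : ℚ} (h₁ : 0 < s₁) (h₂ : 0 < s₂) (V : Fin k → ℚ)
    (ha₁ : blockMax V ≤ s₁ * φ.maxRat) (ha₂ : blockMax V ≤ s₂ * φ.maxRat) (i : Fin k) :
    scaledStep (MiniFloat.valueSet φ) (varSelScale φ s₁ s₂ V) (V i) (fun y => y) = V i := by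
  unfold varSelScale
  split_ifs
  · exact (mx_block_unbiased_iff h₂ V).mpr ha₂ i
  · exact (mx_block_unbiased_iff h₁ V).mpr ha₁ i

/-- … and it has the smaller block variance of the two candidates. -/
theorem blockVar_varSel_le (s₁ s₂ : ℚ) (V : Fin k → ℚ) :
    blockVar φ (varSelScale φ s₁ s₂ V) V ≤ min (blockVar φ s₁ V) (blockVar φ s₂ V) := by
  unfold varSelScale
  split_ifs with h
  · exact le_min h.le le_rfl
  · exact le_min le_rfl (not_lt.mp h)

end Measurable

/-! ### Realised-error selection between two independent stochastic roundings -/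

section Realised

variable {K : Type*} [Field K] [LinearOrder K] [IsStrictOrderedRing K]

/-- Keep the candidate nearer to `v` (ties to the first). -/
def pickNearer (v a b : K) : K := if |b - v| < |a - v| then b else a

/-- **REALISED-ERROR SELECTION, one element**: quantise `v` at scale `s₁` and, independently, at
scale `s₂`; deliver the dequantised candidate nearer to `v`.  Expectation of a test function. -/
def selStep (F : Finset K) (s₁ s₂ v : K) (f : K → K) : K :=
  scaledStep F s₁ v (fun a => scaledStep F s₂ v (fun b => f (pickNearer v a b)))

omit [IsStrictOrderedRing K] in
/-- **When selection never fires**: if both dequantised candidates at scale `s₁` are at least as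
close to `v` as both candidates at scale `s₂`, realised selection always keeps the first copy, so
`selStep = scaledStep s₁` (and the estimate is unbiased if `s₁` is admissible).  The bias of
realised selection is a property of the block, not a universal one. -/
theorem selStep_eq_of_closer {F : Finset K} {s₁ s₂ v : K} (f : K → K)
    (h : ∀ a, a = s₁ * dn F (v / s₁) ∨ a = s₁ * up F (v / s₁) →
      ∀ b, b = s₂ * dn F (v / s₂) ∨ b = s₂ * up F (v / s₂) → |a - v| ≤ |b - v|) :
    selStep F s₁ s₂ v f = scaledStep F s₁ v f := by
  unfold selStep scaledStep
  have inner : ∀ a, a = s₁ * dn F (v / s₁) ∨ a = s₁ * up F (v / s₁) →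
      step F (v / s₂) (fun t => f (pickNearer v a (s₂ * t))) = f a := by
    intro a ha
    have hb : ∀ b, b = s₂ * dn F (v / s₂) ∨ b = s₂ * up F (v / s₂) →
        f (pickNearer v a b) = f a := by
      intro b hb; unfold pickNearer; rw [if_neg (not_lt.mpr (h a ha b hb))]
    rw [step_congr F (v / s₂) (g := fun _ => f a) (hb _ (Or.inr rfl)) (hb _ (Or.inl rfl)),
      step_const]
  exact step_congr F (v / s₁) (inner _ (Or.inr rfl)) (inner _ (Or.inl rfl))

/-- Joint expectation of `g` of the dequantised BLOCK under independent stochastic roundings of its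
elements at scale `s` (list form; the roundings are independent, [ConnollyHighamMary2021] §4). -/
def blockStep (F : Finset K) (s : K) : List K → (List K → K) → K
  | [], g => g []
  | v :: V, g => scaledStep F s v (fun y => blockStep F s V (fun ys => g (y :: ys)))

/-- Realised sum of squared errors of a dequantised copy `A` against the input `V`. -/
def sse : List K → List K → K
  | a :: A, v :: V => (a - v) ^ 2 + sse A V
  | _, _ => 0

/-- **REALISED-SSE SELECTION, block form ("4/6" with SR, [CookEtAl2025] §3.1 MSE rule)**: quantise
the block at `s₁` and, independently, at `s₂`; keep the copy with the smaller realised sum of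
squared errors (ties to the first).  Expectation of a test function of the delivered block. -/
def blockSel (F : Finset K) (s₁ s₂ : K) (V : List K) (g : List K → K) : K :=
  blockStep F s₁ V (fun A => blockStep F s₂ V (fun B => g (if sse B V < sse A V then B else A)))

omit [IsStrictOrderedRing K] in
/-- **Cell pinning**: if `a < c < b` for format values `a, b` with no format value strictly
between them, the SR candidates of `c` are `a` and `b` and the up-probability is the CHM ratio. -/
theorem dn_up_of_cell {F : Finset K} {a b c : K} (ha : a ∈ F) (hb : b ∈ F) (hac : a < c)
    (hcb : c < b) (hgap : ∀ z ∈ F, z ≤ a ∨ b ≤ z) :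
    dn F c = a ∧ up F c = b ∧ pUp F c = (c - a) / (b - a) := by
  have hF : F.Nonempty := ⟨a, ha⟩
  have hH : InHull F c := ⟨⟨a, ha, hac.le⟩, ⟨b, hb, hcb.le⟩⟩
  have hcl : clamp F c = c := clamp_eq_self hH
  have hd : dn F c = a := by
    have h1 : a ≤ dn F c := le_dn_of_mem ha hac.le
    have h2 : dn F c ≤ c := (dn_le_clamp F c).trans hcl.le
    rcases hgap _ (dn_mem hF c) with h | h
    · exact le_antisymm h h1
    · exact absurd (h.trans h2) (not_le.mpr hcb)
  have hu : up F c = b := by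
    have h1 : up F c ≤ b := up_le_of_mem hb hcb.le
    have h2 : c ≤ up F c := hcl.ge.trans (clamp_le_up F c)
    rcases hgap _ (up_mem hF c) with h | h
    · exact absurd (h2.trans h) (not_le.mpr hac)
    · exact le_antisymm h1 h
  refine ⟨hd, hu, ?_⟩
  unfold dn at hd; unfold up at hu; unfold pUp probUp
  rw [hcl] at hd hu ⊢; rw [hd, hu]

end Realised

/-! ### The 4/6 bias in FP4, exactly -/

namespace FP4Sel

/-- The SR marginals of the element `11/2` of the block `(6, 11/2)`: at scale `1` (maximum ↦ 6)
the candidates are `4, 6` with `P(6) = 3/4`; at scale `3/2` (maximum ↦ 4) the scaled value `11/3`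
has candidates `3, 4` (dequantised `9/2, 6`) with `P(6) = 2/3`.  The element `6` is exact under
both scales; both scales are unbiased on the block. -/
theorem marginals :
    dn FP4.e2m1 (11 / 2) = 4 ∧ up FP4.e2m1 (11 / 2) = 6 ∧ pUp FP4.e2m1 (11 / 2) = 3 / 4 ∧
    dn FP4.e2m1 (11 / 2 / (3 / 2)) = 3 ∧ up FP4.e2m1 (11 / 2 / (3 / 2)) = 4 ∧
    pUp FP4.e2m1 (11 / 2 / (3 / 2)) = 2 / 3 ∧
    scaledStep FP4.e2m1 1 6 (fun y => y) = 6 ∧ scaledStep FP4.e2m1 (3 / 2) 6 (fun y => y) = 6 ∧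
    scaledStep FP4.e2m1 1 (11 / 2) (fun y => y) = 11 / 2 ∧
    scaledStep FP4.e2m1 (3 / 2) (11 / 2) (fun y => y) = 11 / 2 := by
  decide +kernel

/-- **REALISED SELECTION IS BIASED (element form)**: keeping the nearer of the two independent
roundings of `11/2` delivers mean `47/8` (bias `+3/8`, toward the nearer grid point `6`), with
either scale as the default; its MSE `5/16` is below both unbiased variances (`3/4` at scale `1`,
`1/2` at scale `3/2`) — "favors reduced quantization error" [CookEtAl2025, A.3], at the price of
the bias. -/
theorem element :
    selStep FP4.e2m1 1 (3 / 2) (11 / 2) (fun y => y) = 47 / 8 ∧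
    selStep FP4.e2m1 (3 / 2) 1 (11 / 2) (fun y => y) = 47 / 8 ∧
    selStep FP4.e2m1 1 (3 / 2) (11 / 2) (fun y => (y - 11 / 2) ^ 2) = 5 / 16 ∧
    scaledStep FP4.e2m1 1 (11 / 2) (fun y => (y - 11 / 2) ^ 2) = 3 / 4 ∧
    scaledStep FP4.e2m1 (3 / 2) (11 / 2) (fun y => (y - 11 / 2) ^ 2) = 1 / 2 := by
  decide +kernel

/-- **REALISED-SSE BLOCK SELECTION IS BIASED ("4/6" with SR)**: on the block `(6, 11/2)` the
published rule (quantise at both scales, keep the smaller realised SSE) delivers the first element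
exactly and the second with mean `47/8 ≠ 11/2`; without selection either scale is unbiased. -/
theorem block :
    blockSel FP4.e2m1 1 (3 / 2) [6, 11 / 2] (fun W => W.getD 0 0) = 6 ∧
    blockSel FP4.e2m1 1 (3 / 2) [6, 11 / 2] (fun W => W.getD 1 0) = 47 / 8 ∧
    blockSel FP4.e2m1 (3 / 2) 1 [6, 11 / 2] (fun W => W.getD 1 0) = 47 / 8 ∧
    blockStep FP4.e2m1 1 [6, 11 / 2] (fun W => W.getD 1 0) = 11 / 2 ∧
    blockStep FP4.e2m1 (3 / 2) [6, 11 / 2] (fun W => W.getD 1 0) = 11 / 2 := by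
  decide +kernel

/-- **NO COUPLING RESCUES UNBIASEDNESS**: for EVERY joint law `p` of the two roundings of `11/2`
with the SR marginals (`P(A = 4) = 1/4` at scale `1`, `P(B = 9/2) = 1/3` at scale `3/2`) — shared
random bits, antithetic bits, independent bits, anything — the nearer-candidate estimate has mean
`≥ 45/8 > 11/2` (the selected value is `6` unless `(A, B) = (4, 9/2)`, an event of probability at
most `1/4`).  Independence gives `47/8`. -/
theorem any_coupling (p : Fin 2 → Fin 2 → ℚ) (hp : ∀ a b, 0 ≤ p a b)
    (hA : p 0 0 + p 0 1 = 1 / 4) (hA' : p 1 0 + p 1 1 = 3 / 4) (hB : p 0 0 + p 1 0 = 1 / 3) :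
    45 / 8 ≤ ∑ a, ∑ b, p a b *
      pickNearer (11 / 2 : ℚ) (if a = 0 then 4 else 6) (if b = 0 then 9 / 2 else 6) := by
  have e1 : pickNearer (11 / 2 : ℚ) 4 (9 / 2) = 9 / 2 := by unfold pickNearer; norm_num
  have e2 : pickNearer (11 / 2 : ℚ) 4 6 = 6 := by unfold pickNearer; norm_num
  have e3 : pickNearer (11 / 2 : ℚ) 6 (9 / 2) = 6 := by unfold pickNearer; norm_num
  have e4 : pickNearer (11 / 2 : ℚ) 6 6 = 6 := by unfold pickNearer; norm_num
  simp only [Fin.sum_univ_two, Fin.isValue, if_true, show (1 : Fin 2) = 0 ↔ False by decide,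
    if_false, e1, e2, e3, e4]
  have hB' := hB
  linarith [hp 0 0, hp 0 1, hp 1 0, hp 1 1]

/-- **The conditional-variance rule on the same block** picks scale `3/2` (block variances
`1/2 < 3/4`; the element `6` contributes `0` under both) and is unbiased (`varSel_unbiased`); on the
block `(6, 1/4)` it picks scale `1` (`1/16 < 1/8`): under SR neither "4" nor "6" dominates, and the
input decides — without bias. -/
theorem varSel_values :
    scaledStep FP4.e2m1 1 (1 / 4) (fun y => (y - 1 / 4) ^ 2) = 1 / 16 ∧
    scaledStep FP4.e2m1 (3 / 2) (1 / 4) (fun y => (y - 1 / 4) ^ 2) = 1 / 8 ∧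
    scaledStep FP4.e2m1 1 6 (fun y => (y - 6) ^ 2) = 0 ∧
    scaledStep FP4.e2m1 (3 / 2) 6 (fun y => (y - 6) ^ 2) = 0 := by
  decide +kernel


/-- The two SR cells of `v ∈ (9/2, 6)` in the 4/6 pair of grids: `(4, 6)` at scale `1` and
`(3, 4)` (dequantised `(9/2, 6)`) at scale `3/2`, with their up-probabilities. -/
theorem cells {v : ℚ} (h1 : 9 / 2 < v) (h2 : v < 6) :
    dn FP4.e2m1 v = 4 ∧ up FP4.e2m1 v = 6 ∧ pUp FP4.e2m1 v = (v - 4) / (6 - 4) ∧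
    dn FP4.e2m1 (v / (3 / 2)) = 3 ∧ up FP4.e2m1 (v / (3 / 2)) = 4 ∧
    pUp FP4.e2m1 (v / (3 / 2)) = (v / (3 / 2) - 3) / (4 - 3) := by
  have m4 : (4 : ℚ) ∈ FP4.e2m1 := by decide +kernel
  have m6 : (6 : ℚ) ∈ FP4.e2m1 := by decide +kernel
  have m3 : (3 : ℚ) ∈ FP4.e2m1 := by decide +kernel
  have g46 : ∀ z ∈ FP4.e2m1, z ≤ (4 : ℚ) ∨ 6 ≤ z := by decide +kernel
  have g34 : ∀ z ∈ FP4.e2m1, z ≤ (3 : ℚ) ∨ 4 ≤ z := by decide +kernel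
  have c1 := dn_up_of_cell m4 m6 (by linarith) h2 g46
  have h3 : 3 < v / (3 / 2) := by rw [lt_div_iff₀ (by norm_num)]; linarith
  have h4 : v / (3 / 2) < 4 := by rw [div_lt_iff₀ (by norm_num)]; linarith
  have c2 := dn_up_of_cell m3 m4 h3 h4 g34
  exact ⟨c1.1, c1.2.1, c1.2.2, c2.1, c2.2.1, c2.2.2⟩

/-- Expansion of the realised-selection mean on `(9/2, 6)` over the four candidate pairs. -/
theorem sel_expand {v : ℚ} (h1 : 9 / 2 < v) (h2 : v < 6) :
    selStep FP4.e2m1 1 (3 / 2) v (fun y => y) =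
      (v - 4) / 2 *
          ((2 * v / 3 - 3) * pickNearer v 6 6 + (1 - (2 * v / 3 - 3)) * pickNearer v 6 (9 / 2))
        + (1 - (v - 4) / 2) *
        ((2 * v / 3 - 3) * pickNearer v 4 6 + (1 - (2 * v / 3 - 3)) * pickNearer v 4 (9 / 2)) := by
  obtain ⟨d1, u1, p1, d2, u2, p2⟩ := cells h1 h2
  unfold selStep scaledStep step
  simp only [div_one, one_mul]
  rw [d1, u1, p1, d2, u2, p2]
  have e1 : (3 / 2 : ℚ) * 4 = 6 := by norm_num
  have e2 : (3 / 2 : ℚ) * 3 = 9 / 2 := by norm_num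
  have e3 : (v / (3 / 2) - 3) / (4 - 3) = 2 * v / 3 - 3 := by field_simp; ring
  have e4 : (v - 4) / (6 - 4) = (v - 4) / 2 := by norm_num
  rw [e1, e2, e3, e4]

/-- **THE 4/6 BIAS CURVE, EXACTLY** (block `(6, v)`, scales `1` and `3/2`, realised selection,
first scale the default): on `(9/2, 5)` the mean is `9/2 + (2/3)(v − 9/2)²` — bias
`−(2/3)(v − 9/2)(6 − v) < 0`; on `(5, 21/4)` the estimate is EXACTLY UNBIASED (the nearer
candidate is always the scale-`3/2` draw); on `[21/4, 6)` the mean is `6 − (6 − v)²/2` — bias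
`(6 − v)(v − 4)/2 > 0`.  The sign of the bias flips inside one binade. [new] -/
theorem curve {v : ℚ} :
    (9 / 2 < v → v < 5 →
      selStep FP4.e2m1 1 (3 / 2) v (fun y => y) = 9 / 2 + 2 / 3 * (v - 9 / 2) ^ 2) ∧
    (5 < v → v < 21 / 4 → selStep FP4.e2m1 1 (3 / 2) v (fun y => y) = v) ∧
    (21 / 4 ≤ v → v < 6 → selStep FP4.e2m1 1 (3 / 2) v (fun y => y) = 6 - (6 - v) ^ 2 / 2) := by
  have k66 : pickNearer v 6 6 = 6 := by unfold pickNearer; exact if_neg (lt_irrefl _)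
  have k49 : 9 / 2 < v → pickNearer v 4 (9 / 2) = 9 / 2 := by
    intro h; unfold pickNearer
    rw [abs_of_neg (by linarith), abs_of_neg (by linarith)]; exact if_pos (by linarith)
  refine ⟨fun h1 h2 => ?_, fun h1 h2 => ?_, fun h1 h2 => ?_⟩
  · have k46 : pickNearer v 4 6 = 4 := by
      unfold pickNearer; rw [abs_of_pos (by linarith), abs_of_neg (by linarith)]
      exact if_neg (by linarith)
    have k69 : pickNearer v 6 (9 / 2) = 9 / 2 := by
      unfold pickNearer; rw [abs_of_neg (by linarith), abs_of_pos (by linarith)]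
      exact if_pos (by linarith)
    rw [sel_expand h1 (by linarith), k66, k49 h1, k46, k69]; ring
  · have k46 : pickNearer v 4 6 = 6 := by
      unfold pickNearer; rw [abs_of_pos (by linarith), abs_of_neg (by linarith)]
      exact if_pos (by linarith)
    have k69 : pickNearer v 6 (9 / 2) = 9 / 2 := by
      unfold pickNearer; rw [abs_of_neg (by linarith), abs_of_pos (by linarith)]
      exact if_pos (by linarith)
    rw [sel_expand (by linarith) (by linarith), k66, k49 (by linarith), k46, k69]; ring
  · have k46 : pickNearer v 4 6 = 6 := by
      unfold pickNearer; rw [abs_of_pos (by linarith), abs_of_neg (by linarith)]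
      exact if_pos (by linarith)
    have k69 : pickNearer v 6 (9 / 2) = 6 := by
      unfold pickNearer; rw [abs_of_neg (by linarith), abs_of_pos (by linarith)]
      exact if_neg (by linarith)
    rw [sel_expand (by linarith) h2, k66, k49 (by linarith), k46, k69]; ring

/-- The witnesses over the substrate `valueSet E2M1` (transport along `e2m1_eq_valueSet`). -/
theorem valueSet_element :
    selStep (MiniFloat.valueSet Format.E2M1) 1 (3 / 2) (11 / 2) (fun y => y) = 47 / 8 ∧
    scaledStep (MiniFloat.valueSet Format.E2M1) 1 (11 / 2) (fun y => y) = 11 / 2 ∧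
    scaledStep (MiniFloat.valueSet Format.E2M1) (3 / 2) (11 / 2) (fun y => y) = 11 / 2 := by
  rw [← e2m1_eq_valueSet]
  exact ⟨element.1, marginals.2.2.2.2.2.2.2.2.1, marginals.2.2.2.2.2.2.2.2.2⟩

end FP4Sel

end Summit.Ventures.CertifiedArithmetic.LowPrec.SR
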